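import Summits.CriticalPhenomena.CardyFormulaZ2.Theses.CardySelfRefinement
import Literature.Probability.RandomPlanarGeometry.SLEUniquenessInLaw

/-!
# Sketch — crux `SubseqUpgrade` (stmt-CriticalPhenomena-10279), crux-ideate round 1, ideator 1

Line `uniqueness-subsequence-principle`. Three declarations, in dependency order:

* `tendsto_nhdsGT_zero_of_forall_pos_seq` — the pure filter fact: a function of the mesh converges
  along `𝓝[>] 0` as soon as along every sequence of POSITIVE meshes tending to `0` some strictly
  increasing subsequence makes it converge (Mathlib `Filter.tendsto_of_subseq_tendsto` on the
  countably generated filter `𝓝[>] 0`, plus the positivity fix-up `s' n = if 0 < s n then s n else 1`,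
  which changes `s` at finitely many indices only).
* `convergesInLawToSLE_of_forall_pos_seq` — FIRST LEMMA of the card (model-free, Literature-level
  sibling of the tree's `convergesInLawToSLE_of_isTightAlongMesh'`, with "tightness + identification"
  replaced by "every positive mesh sequence has a subsequence converging in law to SOME SLE_κ law"):
  uniqueness in law of chordal SLE_κ (`IsSLELaw.eq_map_of_isSLECurve`, PROVED in
  `SLEUniquenessInLaw.lean`) makes all these subsequential limits the law of one SLE_κ random curve
  `Γ`, and the filter fact concludes, test function by test function.
* `subseqUpgrade_holds` — the crux, as the instance `κ = 6`, `Y δ = bondInterfaceIn D (E δ)`,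
  `P δ = bondPercolation (zdGraph 2) half` (clause (ii) specialised to `(D, E)`).
-/

open Filter Topology MeasureTheory
open scoped NNReal BoundedContinuousFunction

namespace Summit.CriticalPhenomena.CardyFormulaZ2.Cruxes.SubseqUpgrade.SketchIdeator1

open Literature.Probability.RandomPlanarGeometry

/-- Pure filter fact behind the subsequence principle along the mesh filter `𝓝[>] 0`: if along
every sequence of positive reals `s n → 0` there is a strictly increasing `φ` with
`x (s (φ n)) → F`, then `x → F` along `𝓝[>] 0`. -/
theorem tendsto_nhdsGT_zero_of_forall_pos_seq {α : Type*} {x : ℝ → α} {F : Filter α}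
    (h : ∀ s : ℕ → ℝ, (∀ n, 0 < s n) → Tendsto s atTop (𝓝 0) →
      ∃ φ : ℕ → ℕ, StrictMono φ ∧ Tendsto (fun n ↦ x (s (φ n))) atTop F) :
    Tendsto x (𝓝[>] (0 : ℝ)) F := by
  classical
  refine tendsto_of_subseq_tendsto fun s hs ↦ ?_
  obtain ⟨hs0, hpos⟩ := tendsto_nhdsWithin_iff.1 hs
  -- positivity fix-up at finitely many indices
  set s' : ℕ → ℝ := fun n ↦ if 0 < s n then s n else 1 with hs'
  have hs'eq : ∀ᶠ n in atTop, s' n = s n := hpos.mono fun n hn ↦ if_pos hn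
  have hs'pos : ∀ n, 0 < s' n := fun n ↦ by
    by_cases hn : 0 < s n
    · simp only [hs', if_pos hn]; exact hn
    · simp only [hs', if_neg hn]; exact one_pos
  have hs'0 : Tendsto s' atTop (𝓝 0) := hs0.congr' (hs'eq.mono fun n hn ↦ hn.symm)
  obtain ⟨φ, hφ, hlim⟩ := h s' hs'pos hs'0
  refine ⟨φ, hlim.congr' ?_⟩
  filter_upwards [hφ.tendsto_atTop.eventually hs'eq] with n hn
  rw [hn]

variable {κ : ℝ≥0} {D : DobrushinDomain} {Ωδ : ℝ → Type*} [∀ δ, MeasurableSpace (Ωδ δ)]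
  {Y : ∀ δ, Ωδ δ → CurveClass ℂ} {P : ∀ δ, Measure (Ωδ δ)}

/-- **FIRST LEMMA (C⁺, model-free).** Convergence in law to chordal SLE_κ from the subsequence
form of the hypothesis: eventual a.e.-measurability, and along every sequence of positive meshes
`s n → 0` a strictly increasing subsequence along which `Y` converges in law (portmanteau form) to
SOME chordal SLE_κ law of `(D; a, b)`. Uniqueness in law of chordal SLE_κ
(`IsSLELaw.eq_map_of_isSLECurve`, proved in tree) identifies all these limits with the law of one
SLE_κ random curve `Γ`; `tendsto_nhdsGT_zero_of_forall_pos_seq` concludes per test function.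
Billingsley (1999) Thm 2.6; Lawler (2005) §6.3. -/
theorem convergesInLawToSLE_of_forall_pos_seq
    (hY : ∀ᶠ δ in 𝓝[>] (0 : ℝ), AEMeasurable (Y δ) (P δ))
    (h : ∀ s : ℕ → ℝ, (∀ n, 0 < s n) → Tendsto s atTop (𝓝 0) →
      ∃ φ : ℕ → ℕ, StrictMono φ ∧ ∃ μ : Measure (CurveClass ℂ), IsSLELaw κ D μ ∧
        ∀ f : CurveClass ℂ →ᵇ ℝ,
          Tendsto (fun n ↦ ∫ ω, f (Y (s (φ n)) ω) ∂P (s (φ n))) atTop (𝓝 (∫ x, f x ∂μ))) :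
    ConvergesInLawToSLE κ D Y P := by
  -- one SLE_κ random curve in `D`, read off the canonical mesh sequence `1/(n+1)`
  obtain ⟨-, -, μ₀, hμ₀, -⟩ := h (fun n ↦ 1 / ((n : ℝ) + 1)) (fun n ↦ Nat.one_div_pos_of_nat)
    tendsto_one_div_add_atTop_nhds_zero_nat
  obtain ⟨Γ, hΓ, -⟩ := hμ₀
  refine ⟨Γ, hΓ, hY, fun f ↦ ?_⟩
  refine tendsto_nhdsGT_zero_of_forall_pos_seq fun s hspos hs0 ↦ ?_
  obtain ⟨φ, hφ, μ, hμ, hlim⟩ := h s hspos hs0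
  refine ⟨φ, hφ, ?_⟩
  have hf := hlim f
  rwa [hμ.eq_map_of_isSLECurve hΓ,
    integral_map hΓ.aemeasurable f.continuous.aestronglyMeasurable] at hf

/-- **The crux** `CardySelfRefinement.SubseqUpgrade` from the first lemma: specialise clause (ii)
to the pair `(D, E)` and apply `convergesInLawToSLE_of_forall_pos_seq` with `κ = 6`. -/
theorem subseqUpgrade_holds :
    Summit.CriticalPhenomena.CardyFormulaZ2.Theses.CardySelfRefinement.SubseqUpgrade := by
  rintro ⟨hmeas, hsub⟩ D E hE
  refine convergesInLawToSLE_of_forall_pos_seq (hmeas D E hE) fun s hspos hs0 ↦ ?_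
  obtain ⟨φ, hφ, Pf, hPf, hconv⟩ := hsub s hspos hs0
  exact ⟨φ, hφ, Pf D, hPf D, fun f ↦ hconv D E hE f⟩

end Summit.CriticalPhenomena.CardyFormulaZ2.Cruxes.SubseqUpgrade.SketchIdeator1
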